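import Summits.KontsevichZagierPeriods.KontsevichZagierPeriods.Theorems.RootDecompRelativeModAbsoluteCylLogSplitP34

/-! # `RootDecompRelativeModAbsoluteCylLogSplitP35` — part 10/27 of the mechanical ≤400-line split of `RungClosure.lean` (sha256 f909f334226f0fb5…)
Source: decomp-kz lens-3 g12 `RungClosure.lean` v9 (HOME/decomp-kz-lens-3/g12/, sha256 f909f334…; critic g4-52/g4-57/g5 CLEARED, «lander: split v9 --supports 30572»): BLOCK I (57 g11 monolith decls missing from P01–P25), BLOCK II/III (WildCertAssembly parts 1–6, 8–10: `Leaf.cellLocalWildCert`, `Leaf.cylKernelZeroLog_of_trees`), Parts 12–13 (`Leaf.regKernelPairDegOne_iff_circlePos_of_trees`), BLOCK G13 (Möbius engine, test §C decided).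
Split by census-1 g9 `gen/splitlean.py`: scopes re-opened with their `open`/`variable`/`set_option` context; mathematics and declaration order unchanged. -/

noncomputable section
open Set MeasureTheory Filter Topology
open scoped BigOperators
open Literature.NumberTheory.Transcendental Literature.ModelTheory.ExponentialFields
namespace Summit.KontsevichZagierPeriods.RootDecompRelativeModAbsolute.Rung30571.RegularisedLogLayer.CylLog.Tame

/-- `σ i ≠ 2` on a cell of fixed signs means `κ i ≠ 0` there. -/
theorem ne_zero_of_sigma_ne_two {q : ℕ} {C : Set (Fin 1 → ℝ)} {κ : Fin q → (Fin 1 → ℝ) → ℝ} {σ : Fin q → Fin 3}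
    (hσ0 : ∀ i, σ i = 0 → ∀ x ∈ C, 0 < κ i x) (hσ1 : ∀ i, σ i = 1 → ∀ x ∈ C, κ i x < 0)
    (i : Fin q) (hi : σ i ≠ 2) : ∀ x ∈ C, κ i x ≠ 0 := by
  intro x hx
  by_cases h0 : σ i = 0
  · exact (hσ0 i h0 x hx).ne'
  · have h1 : σ i = 1 := by
      have hlt := (σ i).isLt
      have h0' : (σ i).val ≠ 0 := fun h => h0 (Fin.ext h)
      have hi' : (σ i).val ≠ 2 := fun h => hi (Fin.ext h)
      apply Fin.ext
      show (σ i).val = 1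
      omega
    exact (hσ1 i h1 x hx).ne

/-- **F2 ASSEMBLED — a piece is TAME when every (nonconstant-`W`) index is of order `M i = 0` or `δ`-away from its
zero on the piece.**  The conclusion is, conjunct for conjunct, `TameCell C c κ M σ` of `CylLogSplit.lean` (§3w; not yet
landed, hence spelled out); hypotheses = the `CellCloseLS` binders restricted to the piece `C` (`.mono` / `.mono_set`),
plus `haway`.  With `CylLogSplit` §3am (`localWildCert_of_signPieces`) this is the TAME half of the g12 target
`LocaliseCell`: after cutting `E` by sign conditions so that each piece has at most one `κᵢ → 0` end with `Mᵢ ≥ 1`, every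
piece WITHOUT such an end is `TameCell` by this theorem and closes by `cellCloseLS_tame` from `BoundaryRigidity` BY NAME —
no o-minimality, no antiderivatives. -/
theorem tameCell_of_away {q : ℕ} {C : Set (Fin 1 → ℝ)} (hC : IsSemialgebraic ℚ C)
    {c κ : Fin q → (Fin 1 → ℝ) → ℝ} {M : Fin q → ℕ} {σ : Fin q → Fin 3}
    (hc : ∀ i, IsSemialgebraicFunOn ℚ C (c i)) (hκ : ∀ i, IsSemialgebraicFunOn ℚ C (κ i))
    (hκ1 : ∀ i, ∀ x ∈ C, -1 < κ i x)
    (hσ0 : ∀ i, σ i = 0 → ∀ x ∈ C, 0 < κ i x) (hσ1 : ∀ i, σ i = 1 → ∀ x ∈ C, κ i x < 0)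
    (hL1 : ∀ i, IntegrableOn (fun x => c i x * ∫ θ in Set.Ioo (0:ℝ) 1, θ ^ M i / (1 + θ * κ i x)) C)
    (haway : ∀ i, σ i ≠ 2 → M i = 0 ∨ ∃ δ : ℝ, 0 < δ ∧ ∀ x ∈ C, δ ≤ |κ i x|) :
    (∀ i, σ i ≠ 2 → IntegrableOn (fun x => c i x / κ i x ^ (M i + 1) * Real.log (1 + κ i x)) C) ∧
    (∀ i, σ i = 0 → ∀ j, j < M i →
      IntegrableOn (fun x => c i x / κ i x ^ (M i + 1) * κ i x ^ (j + 1)) C) := by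
  have hCm : MeasurableSet C := hC.measurableSet_holds
  have hk0 := ne_zero_of_sigma_ne_two hσ0 hσ1
  constructor
  · intro i hi
    rcases haway i hi with hM | ⟨δ, hδ, hδk⟩
    · exact tameLog_of_M_eq_zero hCm hM (hk0 i hi) (hκ1 i) (hL1 i)
    · exact (tame_of_away hC (hc i) (hκ i) (M i) hδ (hκ1 i) hδk (hL1 i)).1
  · intro i hi j hj
    have hi2 : σ i ≠ 2 := by rw [hi]; decide
    rcases haway i hi2 with hM | ⟨δ, hδ, hδk⟩
    · omega
    · exact (tame_of_away hC (hc i) (hκ i) (M i) hδ (hκ1 i) hδk (hL1 i)).2 j hj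

end Summit.KontsevichZagierPeriods.RootDecompRelativeModAbsolute.Rung30571.RegularisedLogLayer.CylLog.Tame

/-! ## Part 2 — `LatticeSplit` (g11 companion, verbatim body) -/

namespace Summit.KontsevichZagierPeriods.RootDecompRelativeModAbsolute.Rung30571.RegularisedLogLayer.CylLog.Lattice

/-- Clearing denominators of a rational vector. -/
theorem exists_nat_mul_eq_int {ι : Type*} [Fintype ι] (v : ι → ℚ) :
    ∃ N : ℕ, 0 < N ∧ ∃ z : ι → ℤ, ∀ i, (N : ℚ) * v i = z i := by
  classical
  refine ⟨∏ i, (v i).den, Finset.prod_pos fun i _ => (v i).den_pos,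
    fun i => (∏ j ∈ Finset.univ.erase i, ((v j).den : ℤ)) * (v i).num, fun i => ?_⟩
  rw [← Finset.mul_prod_erase Finset.univ (fun j => (v j).den) (Finset.mem_univ i)]
  push_cast
  calc ((v i).den : ℚ) * (∏ j ∈ Finset.univ.erase i, ((v j).den : ℚ)) * v i
      = (∏ j ∈ Finset.univ.erase i, ((v j).den : ℚ)) * (v i * (v i).den) := by ring
    _ = (∏ j ∈ Finset.univ.erase i, ((v j).den : ℚ)) * (v i).num := by rw [Rat.mul_den_eq_num]

/-- A rational vector in the `ℚ`-span of integer vectors has an integer multiple in their `ℤ`-span. -/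
theorem exists_nat_mul_mem_zspan {q R : ℕ} (f : Fin R → Fin q → ℤ) {v : Fin q → ℚ}
    (hv : v ∈ Submodule.span ℚ (Set.range fun r i => (f r i : ℚ))) :
    ∃ N : ℕ, 0 < N ∧ ∃ z : Fin R → ℤ, ∀ i, (N : ℚ) * v i = ∑ r, (z r : ℚ) * f r i := by
  obtain ⟨c, hc⟩ := (Submodule.mem_span_range_iff_exists_fun ℚ).1 hv
  obtain ⟨N, hN, z, hz⟩ := exists_nat_mul_eq_int c
  refine ⟨N, hN, z, fun i => ?_⟩
  have hci : v i = ∑ r, c r * (f r i : ℚ) := by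
    rw [← hc]
    simp [Finset.sum_apply, Pi.smul_apply, smul_eq_mul]
  rw [hci, Finset.mul_sum]
  refine Finset.sum_congr rfl fun r _ => ?_
  rw [← mul_assoc, hz r]

/-- **THE LATTICE SPLIT (T1).** -/
theorem latticeSplit (q R : ℕ) (f : Fin R → Fin q → ℤ) (Z : Fin q → Bool) :
    ∃ (a b : ℕ) (g : Fin a → Fin q → ℤ) (h : Fin b → Fin q → ℤ) (A : Fin a → Fin R → ℚ) (B : Fin b → Fin R → ℚ)
      (β : Fin b → Fin q → ℚ),
      (∀ s i, Z i = false → g s i = 0) ∧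
      (∀ s, ∃ N : ℕ, 0 < N ∧ ∃ z : Fin R → ℤ, ∀ i, (N : ℤ) * g s i = ∑ r, z r * f r i) ∧
      (∀ t, ∃ N : ℕ, 0 < N ∧ ∃ z : Fin R → ℤ, ∀ i, (N : ℤ) * h t i = ∑ r, z r * f r i) ∧
      (∀ t k, Z k = true → β t k = 0) ∧
      (∀ r i, (f r i : ℚ) = ∑ s, A s r * g s i + ∑ t, B t r * h t i) ∧
      (∀ t r, B t r = ∑ k, β t k * f r k) := by
  classical
  -- the ambient space, the span, the projection to the tame coordinates
  set F : Fin R → Fin q → ℚ := fun r i => (f r i : ℚ) with hF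
  set V : Submodule ℚ (Fin q → ℚ) := Submodule.span ℚ (Set.range F) with hV
  let Tm := {k : Fin q // Z k = false}
  let π : (Fin q → ℚ) →ₗ[ℚ] (Tm → ℚ) :=
    { toFun := fun v k => v k.1
      map_add' := fun v w => rfl
      map_smul' := fun c v => rfl }
  let ρ : V →ₗ[ℚ] (Tm → ℚ) := π.comp V.subtype
  let K : Submodule ℚ V := LinearMap.ker ρ
  obtain ⟨W, hKW⟩ := Submodule.exists_isCompl K
  -- bases
  haveI : Module.Free ℚ K := Module.Free.of_divisionRing ℚ K
  haveI : Module.Free ℚ W := Module.Free.of_divisionRing ℚ W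
  let bK := Module.finBasis ℚ K
  let bW := Module.finBasis ℚ W
  set a := Module.finrank ℚ K with ha
  set b := Module.finrank ℚ W with hb
  let e : (K × W) ≃ₗ[ℚ] V := Submodule.prodEquivOfIsCompl K W hKW
  let bV : Module.Basis (Fin a ⊕ Fin b) ℚ V := (bK.prod bW).map e
  -- underlying rational vectors
  let uK : Fin a → Fin q → ℚ := fun s => ((bK s : K) : V)
  let uW : Fin b → Fin q → ℚ := fun t => ((bW t : W) : V)
  have hbV_inl : ∀ s, ((bV (Sum.inl s) : V) : Fin q → ℚ) = uK s := by
    intro s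
    simp [bV, uK, e, Module.Basis.map_apply, Module.Basis.prod_apply, Submodule.coe_prodEquivOfIsCompl']
  have hbV_inr : ∀ t, ((bV (Sum.inr t) : V) : Fin q → ℚ) = uW t := by
    intro t
    simp [bV, uW, e, Module.Basis.map_apply, Module.Basis.prod_apply, Submodule.coe_prodEquivOfIsCompl']
  -- support of the `K`-vectors
  have huK_supp : ∀ s (k : Fin q), Z k = false → uK s k = 0 := by
    intro s k hk
    have hmem : ((bK s : K) : V) ∈ K := (bK s).2
    have h0 : ρ ((bK s : K) : V) = 0 := LinearMap.mem_ker.1 hmem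
    have h1 : ρ ((bK s : K) : V) ⟨k, hk⟩ = 0 := by rw [h0]; rfl
    exact h1
  -- integer scalings
  choose NK hNK zK hzK using fun s => exists_nat_mul_eq_int (uK s)
  choose NW hNW zW hzW using fun t => exists_nat_mul_eq_int (uW t)
  -- membership in V of the scaled vectors (as rational vectors)
  have hgV : ∀ s, (fun i => (zK s i : ℚ)) ∈ V := by
    intro s
    have : (fun i => (zK s i : ℚ)) = (NK s : ℚ) • uK s := by
      ext i; simp [Pi.smul_apply, hzK s i]
    rw [this]
    exact V.smul_mem _ ((bK s : K) : V).2
  have hhV : ∀ t, (fun i => (zW t i : ℚ)) ∈ V := by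
    intro t
    have : (fun i => (zW t i : ℚ)) = (NW t : ℚ) • uW t := by
      ext i; simp [Pi.smul_apply, hzW t i]
    rw [this]
    exact V.smul_mem _ ((bW t : W) : V).2
  -- the W-coordinate functionals vanish on K and factor through ρ
  have hcoordK : ∀ t (v : V), v ∈ K → bV.repr v (Sum.inr t) = 0 := by
    intro t v hv
    have : bV.repr v = (bK.prod bW).repr (e.symm v) := by simp [bV]
    rw [this]
    have hsymm : e.symm v = ((⟨v, hv⟩ : K), 0) := Submodule.prodEquivOfIsCompl_symm_apply_left K W hKW ⟨v, hv⟩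
    rw [hsymm, Module.Basis.prod_repr_inr]
    simp
  have hfactor : ∀ t, ∃ φ : (Tm → ℚ) →ₗ[ℚ] ℚ, ∀ v : V, φ (ρ v) = bV.repr v (Sum.inr t) := by
    intro t
    let ct : V →ₗ[ℚ] ℚ := bV.coord (Sum.inr t)
    have hle : K ≤ LinearMap.ker ct := fun v hv => by
      rw [LinearMap.mem_ker]
      exact hcoordK t v hv
    let f₀ : LinearMap.range ρ →ₗ[ℚ] ℚ := (K.liftQ ct hle).comp (ρ.quotKerEquivRange.symm : LinearMap.range ρ →ₗ[ℚ] V ⧸ K)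
    obtain ⟨φ, hφ⟩ := LinearMap.exists_extend f₀
    refine ⟨φ, fun v => ?_⟩
    have hmem : ρ v ∈ LinearMap.range ρ := LinearMap.mem_range_self ρ v
    have h1 : φ (ρ v) = f₀ ⟨ρ v, hmem⟩ := by
      have := LinearMap.congr_fun hφ ⟨ρ v, hmem⟩
      simpa using this
    rw [h1]
    simp only [f₀, LinearMap.comp_apply, LinearEquiv.coe_coe, LinearMap.quotKerEquivRange_symm_apply_image,
      Submodule.mkQ_apply, Submodule.liftQ_apply]
    rfl
  choose φ hφ using hfactor
  -- the data
  let fr : Fin R → V := fun r => ⟨F r, Submodule.subset_span ⟨r, rfl⟩⟩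
  refine ⟨a, b, zK, zW, fun s r => bV.repr (fr r) (Sum.inl s) / NK s, fun t r => bV.repr (fr r) (Sum.inr t) / NW t,
    fun t k => if hk : Z k = false then φ t (Pi.single (⟨k, hk⟩ : Tm) 1) / NW t else 0,
    ?_, ?_, ?_, ?_, ?_, ?_⟩
  · -- support of g
    intro s i hi
    have h1 := hzK s i
    rw [huK_supp s i hi, mul_zero] at h1
    exact_mod_cast h1.symm
  · -- g_s has an integer multiple in the ℤ-span of the f_r
    intro s
    obtain ⟨N, hN, z, hz⟩ := exists_nat_mul_mem_zspan f (hgV s)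
    exact ⟨N, hN, z, fun i => by exact_mod_cast hz i⟩
  · intro t
    obtain ⟨N, hN, z, hz⟩ := exists_nat_mul_mem_zspan f (hhV t)
    exact ⟨N, hN, z, fun i => by exact_mod_cast hz i⟩
  · -- β supported off Z
    intro t k hk
    simp [hk]
  · -- (I1): f_r = Σ A g + Σ B h
    intro r i
    beta_reduce
    have hsum := bV.sum_repr (fr r)
    have hcoe := congr_arg (fun v : V => (V.subtype v) i) hsum
    simp only [map_add, map_sum, map_smul, Fintype.sum_sum_type, Finset.sum_apply, Pi.add_apply,
      Pi.smul_apply, smul_eq_mul, Submodule.subtype_apply, hbV_inl, hbV_inr] at hcoe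
    have hfr : ((fr r : V) : Fin q → ℚ) i = (f r i : ℚ) := rfl
    rw [hfr] at hcoe
    rw [← hcoe]
    congr 1
    · refine Finset.sum_congr rfl fun s _ => ?_
      have hN : (NK s : ℚ) ≠ 0 := by exact_mod_cast (hNK s).ne'
      rw [← hzK s i]
      field_simp
    · refine Finset.sum_congr rfl fun t _ => ?_
      have hN : (NW t : ℚ) ≠ 0 := by exact_mod_cast (hNW t).ne'
      rw [← hzW t i]
      field_simp
  · -- (I2): B_tr = Σ_k β_tk f_rk  (KEY FACT)
    intro t r
    beta_reduce
    have hN : (NW t : ℚ) ≠ 0 := by exact_mod_cast (hNW t).ne'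
    have key : bV.repr (fr r) (Sum.inr t) = φ t (ρ (fr r)) := (hφ t (fr r)).symm
    -- ρ (fr r) = Σ_{k : Tm} F r k • single k 1
    have hρ : ρ (fr r) = ∑ k : Tm, F r k.1 • Pi.single (M := fun _ => ℚ) k 1 := by
      have := pi_eq_sum_univ' (ρ (fr r))
      simpa [ρ, π, fr] using this
    rw [key, hρ, map_sum]
    simp only [map_smul, smul_eq_mul]
    -- split the sum over Fin q into Z k = false and Z k = true parts
    rw [← Fintype.sum_subtype_add_sum_subtype (fun k => Z k = false)
      (fun k => (if hk : Z k = false then φ t (Pi.single (⟨k, hk⟩ : Tm) 1) / NW t else 0) * (f r k : ℚ))]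
    have hzero : ∑ k : {x // ¬ Z x = false},
        (if hk : Z (k : Fin q) = false then φ t (Pi.single (⟨k, hk⟩ : Tm) 1) / NW t else 0) * (f r k : ℚ) = 0 := by
      refine Finset.sum_eq_zero fun k _ => ?_
      simp [k.2]
    rw [hzero, add_zero, Finset.sum_div]
    refine Finset.sum_congr rfl fun k _ => ?_
    have hk : Z k.1 = false := k.2
    simp only [hk, dif_pos]
    simp [F, mul_comm, mul_div_assoc]

/-- **Integer multiples of relations are relations** (positivity of the edges): if `N·g = Σ_r z_r f_r` with `N ≥ 1` and
`∏ Wᵢ^{f_ri} = 1` for all `r` (all `Wᵢ > 0`), then `∏ Wᵢ^{gᵢ} = 1`.  Turns the output of `latticeSplit` into the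
clause `hrel` of `WildCellCert` (and the relation property of the `h_t`, used for `hsumN`). -/
theorem prod_zpow_eq_one_of_int_combination {q R : ℕ} {f : Fin R → Fin q → ℤ} {g : Fin q → ℤ} {N : ℕ} (hN : 0 < N)
    {z : Fin R → ℤ} (hg : ∀ i, (N : ℤ) * g i = ∑ r, z r * f r i) {W : Fin q → ℝ} (hW : ∀ i, 0 < W i)
    (hrel : ∀ r, ∏ i, W i ^ (f r i) = 1) : ∏ i, W i ^ (g i) = 1 := by
  have hlogrel : ∀ r, ∑ i, (f r i : ℝ) * Real.log (W i) = 0 := by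
    intro r
    have h := congr_arg Real.log (hrel r)
    rw [Real.log_one, Real.log_prod (s := Finset.univ) (fun i _ => (zpow_pos (hW i) _).ne')] at h
    simpa [Real.log_zpow] using h
  have hsum : ∑ i, (g i : ℝ) * Real.log (W i) = 0 := by
    have hN' : (N : ℝ) ≠ 0 := by exact_mod_cast hN.ne'
    have h1 : (N : ℝ) * ∑ i, (g i : ℝ) * Real.log (W i) = ∑ r, (z r : ℝ) * ∑ i, (f r i : ℝ) * Real.log (W i) := by
      rw [Finset.mul_sum]
      have h2 : ∀ i, (N : ℝ) * ((g i : ℝ) * Real.log (W i)) = ∑ r, (z r : ℝ) * ((f r i : ℝ) * Real.log (W i)) := by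
        intro i
        have h3 : (N : ℝ) * (g i : ℝ) = ∑ r, (z r : ℝ) * (f r i : ℝ) := by exact_mod_cast hg i
        rw [← mul_assoc, h3, Finset.sum_mul]
        refine Finset.sum_congr rfl fun r _ => ?_
        ring
      rw [Finset.sum_congr rfl fun i _ => h2 i, Finset.sum_comm]
      refine Finset.sum_congr rfl fun r _ => ?_
      rw [Finset.mul_sum]
    have h4 : (N : ℝ) * ∑ i, (g i : ℝ) * Real.log (W i) = 0 := by
      rw [h1]
      exact Finset.sum_eq_zero fun r _ => by rw [hlogrel r, mul_zero]
    rcases mul_eq_zero.1 h4 with h5 | h5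
    · exact absurd h5 hN'
    · exact h5
  have hP : 0 < ∏ i, W i ^ (g i) := Finset.prod_pos fun i _ => zpow_pos (hW i) _
  have hlogP : Real.log (∏ i, W i ^ (g i)) = 0 := by
    rw [Real.log_prod (s := Finset.univ) (fun i _ => (zpow_pos (hW i) _).ne')]
    simpa [Real.log_zpow] using hsum
  rw [← Real.exp_log hP, hlogP, Real.exp_zero]

/-- **Pointwise (real) form of the lattice split**, as used on a cell: for real coefficients `qq_r`, the vector
`d̂ = Σ_r qq_r f_r` is `Σ_s qq'_s g_s + Σ_t pp_t h_t` with `qq'_s = Σ_r A_sr qq_r`, `pp_t = Σ_r B_tr qq_r`, and the KEY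
FACT `pp_t = Σ_k β_tk d̂_k` with `β` supported off `Z`. -/
theorem latticeSplit_real {q R a b : ℕ} {f : Fin R → Fin q → ℤ} {g : Fin a → Fin q → ℤ}
    {h : Fin b → Fin q → ℤ} {A : Fin a → Fin R → ℚ} {B : Fin b → Fin R → ℚ} {β : Fin b → Fin q → ℚ}
    (hI1 : ∀ r i, (f r i : ℚ) = ∑ s, A s r * g s i + ∑ t, B t r * h t i)
    (hI2 : ∀ t r, B t r = ∑ k, β t k * f r k) (qq : Fin R → ℝ) :
    (∀ i, ∑ r, qq r * (f r i : ℝ) =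
      ∑ s, (∑ r, (A s r : ℝ) * qq r) * (g s i : ℝ) + ∑ t, (∑ r, (B t r : ℝ) * qq r) * (h t i : ℝ)) ∧
    (∀ t, ∑ r, (B t r : ℝ) * qq r = ∑ k, (β t k : ℝ) * ∑ r, qq r * (f r k : ℝ)) := by
  constructor
  · intro i
    have hc : ∀ r, (f r i : ℝ) = ∑ s, (A s r : ℝ) * (g s i : ℝ) + ∑ t, (B t r : ℝ) * (h t i : ℝ) := by
      intro r
      have := congr_arg (fun x : ℚ => (x : ℝ)) (hI1 r i)
      push_cast at this
      exact_mod_cast this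
    simp_rw [hc, mul_add, Finset.mul_sum, Finset.sum_add_distrib]
    congr 1
    · rw [Finset.sum_comm]
      refine Finset.sum_congr rfl fun s _ => ?_
      rw [Finset.sum_mul]
      refine Finset.sum_congr rfl fun r _ => ?_
      ring
    · rw [Finset.sum_comm]
      refine Finset.sum_congr rfl fun t _ => ?_
      rw [Finset.sum_mul]
      refine Finset.sum_congr rfl fun r _ => ?_
      ring
  · intro t
    have hc : ∀ r, (B t r : ℝ) = ∑ k, (β t k : ℝ) * (f r k : ℝ) := by
      intro r
      have := congr_arg (fun x : ℚ => (x : ℝ)) (hI2 t r)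
      push_cast at this
      exact_mod_cast this
    simp_rw [hc, Finset.sum_mul, Finset.mul_sum]
    rw [Finset.sum_comm]
    refine Finset.sum_congr rfl fun k _ => Finset.sum_congr rfl fun r _ => ?_
    ring

end Summit.KontsevichZagierPeriods.RootDecompRelativeModAbsolute.Rung30571.RegularisedLogLayer.CylLog.Lattice

/-! ## Part 3 — `PieceDichotomy` (g11 companion, verbatim body) -/

namespace Summit.KontsevichZagierPeriods.RootDecompRelativeModAbsolute.Rung30571.RegularisedLogLayer.CylLogLeaf

end Summit.KontsevichZagierPeriods.RootDecompRelativeModAbsolute.Rung30571.RegularisedLogLayer.CylLogLeaf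
end
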